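import Summits.KontsevichZagierPeriods.KontsevichZagierPeriods.Theorems.RootDecompWalshStrataConeChart

/-!
# The cone specimen, part 2/3: the Newton–Leibniz moves and the device certificate

`coneRung_mem_relations : 3•[(0,1)³ ∩ {z² > x²+y²}, 1] − [(0,1)³ ∩ {1 > x²+y²}, 1] ∈ KZ.relations` (the
critic-blessed `d = 3` device certificate of cell decomp-kz lens 4; `3·π/12 = π/4`), `coneDisc_mem_relations`
(`3•[cone] − [quarter disc]`) and `of_cone_sub_of_discThird_mem_relations` (`[cone, 1] − [quarter disc, 1/3]`):
rule (3) over the quarter disc with the polynomial primitives `z³`, `z`, `z³/3` (`KZ.exists_band_newtonLeibniz`),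
null faces (`KZ.of_sub_of_restrict_openBand_mem_relations`), pinning. Imports: part 1 of the specimen (hence Literature + the landed Walsh-cell module); 0 sorry.
[KontsevichZagier2001 §1.2 rules (1)–(3)]
-/

noncomputable section

open Literature.NumberTheory.Transcendental
open MeasureTheory Set
open MvPolynomial (aeval X C)
open Literature.ModelTheory.ExponentialFields (IsSemialgebraic isSemialgebraic_setOf_eval_pos
  isSemialgebraic_setOf_eval_lt continuous_aeval_real)
open Summit.KontsevichZagierPeriods.RootDecompWalshStrata.WalshSpanProof (isSemialgebraic_cubeSet
  isBounded_cubeSet cellRep cellRep_domain cellRep_integrand)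

namespace Summit.KontsevichZagierPeriods.RootDecompWalshStrata.ConeSpecimen

/-- **Moves (3) + (1a):** `[cyl, 3z²] ≡ [quarter disc, 1]` — Newton–Leibniz along `z` with the
primitive `z³` over the quarter disc (closed fibres `[0,1]`), then opening the fibres (null faces).
[KontsevichZagier2001 §1.2 rules (1), (3)] -/
theorem of_cylThreeSq_sub_of_disc_mem_relations :
    KZ.of (polyRep cylPoly (X 2 ^ 2 + X 2 ^ 2 + X 2 ^ 2)) - KZ.of (cellRep discPoly 1) ∈
      KZ.relations := by
  have hBs := isSemialgebraic_discBase
  have ha : IsSemialgebraicFunOn ℚ discBase (fun _ => (0:ℝ)) := by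
    simpa using isSemialgebraicFunOn_ratCast hBs 0
  have hb : IsSemialgebraicFunOn ℚ discBase (fun _ => (1:ℝ)) := by
    simpa using isSemialgebraicFunOn_ratCast hBs 1
  have hband : IsSemialgebraic ℚ (KZlog.band discBase (fun _ => (0:ℝ)) (fun _ => 1)) :=
    KZlog.isSemialgebraic_band ha hb
  obtain ⟨rb, rd, hrbd, hrbi, hrdd, hrdi, hrel⟩ := KZ.exists_band_newtonLeibniz hBs
    (fun _ => (0:ℝ)) (fun _ => 1) ha hb (fun _ _ => zero_le_one)
    (fun w => w (Fin.last 2) ^ 3) (fun w => 3 * w (Fin.last 2) ^ 2)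
    ((isSemialgebraicFunOn_aeval hband (X (Fin.last 2) ^ 3)).congr fun w _ => by simp)
    ((isSemialgebraicFunOn_aeval hband (3 * X (Fin.last 2) ^ 2)).congr fun w _ => by simp)
    (fun x _ => by
      simp only [Fin.snoc_last]
      exact (continuous_pow 3).continuousOn)
    (fun x _ t _ => by
      simp only [Fin.snoc_last]
      simpa using hasDerivAt_pow 3 t)
    (((continuous_const.mul ((continuous_apply _).pow 2)).continuousOn.integrableOn_compact
      isCompact_Icc).mono_set band_discBase_subset_Icc)
    (hb.congr fun x _ => by simp only [Fin.snoc_last]; norm_num)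
    (by
      have : (fun x : Fin 2 → ℝ => (Fin.snoc x ((fun _ => (1:ℝ)) x) : Fin 3 → ℝ) (Fin.last 2) ^ 3 -
          (Fin.snoc x ((fun _ => (0:ℝ)) x) : Fin 3 → ℝ) (Fin.last 2) ^ 3) = fun _ => (1:ℝ) := by
        funext x; simp only [Fin.snoc_last]; norm_num
      rw [this]
      exact integrableOn_const
        (hs := (((isBounded_cubeSet 2).subset fun x hx => hx.1).measure_lt_top).ne))
  obtain ⟨rb', hrb'd, hrb'i, hrel'⟩ := KZ.of_sub_of_restrict_openBand_mem_relations ha hb rb hrbd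
  have hpin1 : KZ.of rb' - KZ.of (polyRep cylPoly (X 2 ^ 2 + X 2 ^ 2 + X 2 ^ 2)) ∈ KZ.relations := by
    refine KZ.of_sub_of_mem_relations_of_eqOn ?_ fun w _ => ?_
    · rw [hrb'd]
      ext z
      simpa using mem_cyl_iff_init z
    · rw [hrb'i, hrbi]
      simp
      ring
  have hpin2 : KZ.of rd - KZ.of (cellRep discPoly 1) ∈ KZ.relations := by
    refine KZ.of_sub_of_mem_relations_of_eqOn ?_ fun u _ => ?_
    · rw [cellRep_domain, hrdd]; rfl
    · rw [hrdi]; simp only [Fin.snoc_last, cellRep_integrand]; norm_num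
  have : KZ.of (polyRep cylPoly (X 2 ^ 2 + X 2 ^ 2 + X 2 ^ 2)) - KZ.of (cellRep discPoly 1) =
      (KZ.of rb - KZ.of rd) - (KZ.of rb - KZ.of rb') -
        (KZ.of rb' - KZ.of (polyRep cylPoly (X 2 ^ 2 + X 2 ^ 2 + X 2 ^ 2))) +
        (KZ.of rd - KZ.of (cellRep discPoly 1)) := by abel
  rw [this]
  exact add_mem (sub_mem (sub_mem hrel hrel') hpin1) hpin2

/-- **Moves (3) + (1a):** `[cyl, 1] ≡ [quarter disc, 1]` — Newton–Leibniz along `z` with the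
primitive `z`, then opening the fibres. [KontsevichZagier2001 §1.2 rules (1), (3)] -/
theorem of_cyl_sub_of_disc_mem_relations :
    KZ.of (cellRep cylPoly 1) - KZ.of (cellRep discPoly 1) ∈ KZ.relations := by
  have hBs := isSemialgebraic_discBase
  have ha : IsSemialgebraicFunOn ℚ discBase (fun _ => (0:ℝ)) := by
    simpa using isSemialgebraicFunOn_ratCast hBs 0
  have hb : IsSemialgebraicFunOn ℚ discBase (fun _ => (1:ℝ)) := by
    simpa using isSemialgebraicFunOn_ratCast hBs 1
  have hband : IsSemialgebraic ℚ (KZlog.band discBase (fun _ => (0:ℝ)) (fun _ => 1)) :=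
    KZlog.isSemialgebraic_band ha hb
  obtain ⟨rb, rd, hrbd, hrbi, hrdd, hrdi, hrel⟩ := KZ.exists_band_newtonLeibniz hBs
    (fun _ => (0:ℝ)) (fun _ => 1) ha hb (fun _ _ => zero_le_one)
    (fun w => w (Fin.last 2)) (fun _ => 1)
    ((isSemialgebraicFunOn_aeval hband (X (Fin.last 2))).congr fun w _ => by simp)
    (by simpa using isSemialgebraicFunOn_ratCast hband 1)
    (fun x _ => by
      simp only [Fin.snoc_last]
      exact continuous_id.continuousOn)
    (fun x _ t _ => by
      simp only [Fin.snoc_last]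
      exact hasDerivAt_id t)
    (integrableOn_const (hs := ((measure_mono band_discBase_subset_Icc).trans_lt
      (isCompact_Icc.measure_lt_top)).ne))
    (hb.congr fun x _ => by simp only [Fin.snoc_last]; norm_num)
    (by
      have : (fun x : Fin 2 → ℝ => (Fin.snoc x ((fun _ => (1:ℝ)) x) : Fin 3 → ℝ) (Fin.last 2) -
          (Fin.snoc x ((fun _ => (0:ℝ)) x) : Fin 3 → ℝ) (Fin.last 2)) = fun _ => (1:ℝ) := by
        funext x; simp only [Fin.snoc_last]; norm_num
      rw [this]
      exact integrableOn_const
        (hs := (((isBounded_cubeSet 2).subset fun x hx => hx.1).measure_lt_top).ne))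
  obtain ⟨rb', hrb'd, hrb'i, hrel'⟩ := KZ.of_sub_of_restrict_openBand_mem_relations ha hb rb hrbd
  have hpin1 : KZ.of rb' - KZ.of (cellRep cylPoly 1) ∈ KZ.relations := by
    refine KZ.of_sub_of_mem_relations_of_eqOn ?_ fun w _ => ?_
    · rw [hrb'd]
      ext z
      simpa using mem_cyl_iff_init z
    · rw [hrb'i, hrbi]
      simp
  have hpin2 : KZ.of rd - KZ.of (cellRep discPoly 1) ∈ KZ.relations := by
    refine KZ.of_sub_of_mem_relations_of_eqOn ?_ fun u _ => ?_
    · rw [cellRep_domain, hrdd]; rfl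
    · rw [hrdi]; simp only [Fin.snoc_last, cellRep_integrand]; norm_num
  have : KZ.of (cellRep cylPoly 1) - KZ.of (cellRep discPoly 1) =
      (KZ.of rb - KZ.of rd) - (KZ.of rb - KZ.of rb') - (KZ.of rb' - KZ.of (cellRep cylPoly 1)) +
        (KZ.of rd - KZ.of (cellRep discPoly 1)) := by abel
  rw [this]
  exact add_mem (sub_mem (sub_mem hrel hrel') hpin1) hpin2

/-! #### The specimen -/

/-- **Quadric descent, first instance (dimension 3 → 2):**
`3·[(0,1)³ ∩ {x² + y² < z²}, 1] − [(0,1)² ∩ {x² + y² < 1}, 1] ∈ KZ.relations`.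
[KontsevichZagier2001 §1.2 rules (1)–(3); this node] -/
theorem coneDisc_mem_relations :
    3 • KZ.of (cellRep conePoly 1) - KZ.of (cellRep discPoly 1) ∈ KZ.relations := by
  have h0 := of_cellRep_sub_of_polyRep_C_mem_relations conePoly 1
  have h1 := of_cylSq_sub_of_cone_mem_relations
  have h2 := of_polyRep_three_sub_mem_relations cylPoly (X 2 ^ 2)
  have h3 := of_cylThreeSq_sub_of_disc_mem_relations
  have : 3 • KZ.of (cellRep conePoly 1) - KZ.of (cellRep discPoly 1) =
      (KZ.of (polyRep cylPoly (X 2 ^ 2 + X 2 ^ 2 + X 2 ^ 2)) - KZ.of (cellRep discPoly 1)) -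
        (KZ.of (polyRep cylPoly (X 2 ^ 2 + X 2 ^ 2 + X 2 ^ 2)) - 3 • KZ.of (polyRep cylPoly (X 2 ^ 2))) -
        3 • (KZ.of (polyRep cylPoly (X 2 ^ 2)) - KZ.of (cellRep conePoly 1)) := by abel
  rw [this]
  exact sub_mem (sub_mem h3 h2) (AddSubgroup.nsmul_mem _ h1 3)

/-- **The cone specimen (critic-blessed d = 3 device certificate, kernel form in the quadric
stratum):** `3·[(0,1)³ ∩ {z² > x² + y²}, 1] − [(0,1)³ ∩ {1 > x² + y²}, 1] ∈ KZ.relations`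
(`3·π/12 − π/4 = 0`). An instance of `QuadricThree` with `k = 2`, `d = (3, 3)`, `c = (3, −1)`
decided INSIDE the rules. [KontsevichZagier2001 §1.2; this node] -/
theorem coneRung_mem_relations :
    3 • KZ.of (cellRep conePoly 1) - KZ.of (cellRep cylPoly 1) ∈ KZ.relations := by
  have h1 := coneDisc_mem_relations
  have h2 := of_cyl_sub_of_disc_mem_relations
  have : 3 • KZ.of (cellRep conePoly 1) - KZ.of (cellRep cylPoly 1) =
      (3 • KZ.of (cellRep conePoly 1) - KZ.of (cellRep discPoly 1)) -
        (KZ.of (cellRep cylPoly 1) - KZ.of (cellRep discPoly 1)) := by abel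
  rw [this]
  exact sub_mem h1 h2


/-! #### `[cyl, z²] ≡ [Q, 1/3]` -/

/-- **Moves (3) + (1a):** `[cyl, z²] ≡ [quarter disc, 1/3]` — Newton–Leibniz along `z` with the
primitive `z³/3`, then opening the fibres. [KontsevichZagier2001 §1.2 rules (1), (3)] -/
theorem of_cylSq_sub_of_discThird_mem_relations :
    KZ.of (polyRep cylPoly (X 2 ^ 2)) - KZ.of (cellRep discPoly (1 / 3)) ∈ KZ.relations := by
  have hBs := isSemialgebraic_discBase
  have ha : IsSemialgebraicFunOn ℚ discBase (fun _ => (0:ℝ)) := by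
    simpa using isSemialgebraicFunOn_ratCast hBs 0
  have hb : IsSemialgebraicFunOn ℚ discBase (fun _ => (1:ℝ)) := by
    simpa using isSemialgebraicFunOn_ratCast hBs 1
  have hband : IsSemialgebraic ℚ (KZlog.band discBase (fun _ => (0:ℝ)) (fun _ => 1)) :=
    KZlog.isSemialgebraic_band ha hb
  obtain ⟨rb, rd, hrbd, hrbi, hrdd, hrdi, hrel⟩ := KZ.exists_band_newtonLeibniz hBs
    (fun _ => (0:ℝ)) (fun _ => 1) ha hb (fun _ _ => zero_le_one)
    (fun w => w (Fin.last 2) ^ 3 / 3) (fun w => w (Fin.last 2) ^ 2)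
    ((isSemialgebraicFunOn_aeval_div_aeval hband (X (Fin.last 2) ^ 3) (C 3) fun w _ => by simp).congr
      fun w _ => by simp)
    ((isSemialgebraicFunOn_aeval hband (X (Fin.last 2) ^ 2)).congr fun w _ => by simp)
    (fun x _ => by
      simp only [Fin.snoc_last]
      exact ((continuous_pow 3).div_const 3).continuousOn)
    (fun x _ t _ => by
      simp only [Fin.snoc_last]
      exact ((hasDerivAt_pow 3 t).div_const 3).congr_deriv (by ring))
    ((((continuous_apply _).pow 2)).continuousOn.integrableOn_compact
      isCompact_Icc |>.mono_set band_discBase_subset_Icc)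
    ((isSemialgebraicFunOn_ratCast hBs (1 / 3)).congr fun x _ => by simp only [Fin.snoc_last]; norm_num)
    (by
      have : (fun x : Fin 2 → ℝ => (Fin.snoc x ((fun _ => (1:ℝ)) x) : Fin 3 → ℝ) (Fin.last 2) ^ 3 / 3 -
          (Fin.snoc x ((fun _ => (0:ℝ)) x) : Fin 3 → ℝ) (Fin.last 2) ^ 3 / 3) = fun _ => (1:ℝ) / 3 := by
        funext x; simp only [Fin.snoc_last]; norm_num
      rw [this]
      exact integrableOn_const
        (hs := (((isBounded_cubeSet 2).subset fun x hx => hx.1).measure_lt_top).ne))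
  obtain ⟨rb', hrb'd, hrb'i, hrel'⟩ := KZ.of_sub_of_restrict_openBand_mem_relations ha hb rb hrbd
  have hpin1 : KZ.of rb' - KZ.of (polyRep cylPoly (X 2 ^ 2)) ∈ KZ.relations := by
    refine KZ.of_sub_of_mem_relations_of_eqOn ?_ fun w _ => ?_
    · rw [hrb'd]
      ext z
      simpa using mem_cyl_iff_init z
    · rw [hrb'i, hrbi]
      simp
  have hpin2 : KZ.of rd - KZ.of (cellRep discPoly (1 / 3)) ∈ KZ.relations := by
    refine KZ.of_sub_of_mem_relations_of_eqOn ?_ fun u _ => ?_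
    · rw [cellRep_domain, hrdd]; rfl
    · rw [hrdi]; simp only [Fin.snoc_last, cellRep_integrand]; norm_num
  have : KZ.of (polyRep cylPoly (X 2 ^ 2)) - KZ.of (cellRep discPoly (1 / 3)) =
      (KZ.of rb - KZ.of rd) - (KZ.of rb - KZ.of rb') - (KZ.of rb' - KZ.of (polyRep cylPoly (X 2 ^ 2))) +
        (KZ.of rd - KZ.of (cellRep discPoly (1 / 3))) := by abel
  rw [this]
  exact add_mem (sub_mem (sub_mem hrel hrel') hpin1) hpin2

/-- `[cone, 1] ≡ [quarter disc, 1/3]` (`π/12 = (1/3)·(π/4)`): the 3 → 2 descent of the cone with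
no integer multiple. [KontsevichZagier2001 §1.2; this node] -/
theorem of_cone_sub_of_discThird_mem_relations :
    KZ.of (cellRep conePoly 1) - KZ.of (cellRep discPoly (1 / 3)) ∈ KZ.relations := by
  have h1 := of_cylSq_sub_of_cone_mem_relations
  have h2 := of_cylSq_sub_of_discThird_mem_relations
  have : KZ.of (cellRep conePoly 1) - KZ.of (cellRep discPoly (1 / 3)) =
      (KZ.of (polyRep cylPoly (X 2 ^ 2)) - KZ.of (cellRep discPoly (1 / 3))) -
        (KZ.of (polyRep cylPoly (X 2 ^ 2)) - KZ.of (cellRep conePoly 1)) := by abel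
  rw [this]
  exact sub_mem h2 h1


end Summit.KontsevichZagierPeriods.RootDecompWalshStrata.ConeSpecimen

end
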